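import Literature.NumberTheory.DiophantineGeometry.LocalReductionProofs
import Literature.NumberTheory.DiophantineGeometry.LocalReductionFiniteBadPlacesProofs
import Literature.NumberTheory.DiophantineGeometry.LocalReductionHasMultiplicativeReductionAtProofs
import HarnessLib

/-!
# Additive reduction at a finite place — the predicate is not universally true; Silverman's criterion

`WeierstrassCurve.HasAdditiveReductionAt v W` (stated in
`Literature.NumberTheory.DiophantineGeometry.LocalReduction`) is a *definition* — the notion "`W / K`
has additive (cuspidal, unstable) reduction at the finite place `v`", i.e. the chosen local minimal
model at `v` has `v (Δ) < 1` and `v (c₄) < 1` multiplicatively (Silverman, AEC VII.5, Definition and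
Prop. 5.1(c), PDF p. 174 of the held copy: "E has additive reduction if and only if `v(Δ) > 0` and
`v(c_4) > 0`, i.e., `Δ, c_4 ∈ 𝓜`"). It is a two-argument predicate, not a named fact, so there is
no `HasAdditiveReductionAt_holds`; this file records the formal reason (at every finite place some
Weierstrass equation has *good* reduction) and Silverman's criterion VII.5.1(c) read on an
equation over `K`: the necessary direction on an arbitrary integral equation, and the sufficient
direction via the `c₄`-half of Remark VII.1.1. It is kept in its own sibling file (like
`LocalReductionHasGoodReductionAtProofs`, `LocalReductionHasMultiplicativeReductionAtProofs`) so as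
not to interfere with `LocalReductionProofs`, whose smul-invariance results it uses.

* `WeierstrassCurve.exists_hasGoodReductionAt`: at every finite place `v` of `K = Frac A` some
  Weierstrass equation over `K` has good reduction: `y² + y = x³` (`Δ = -27`) if `3 ∉ v`, and
  `y² + xy = x³ - x` (`Δ = 65 = 22 · 3 - 1`) if `3 ∈ v` (AEC VII.5, Prop. 5.1(a) via the tree's
  `hasGoodReductionAt_of_valuation_le_one_of_valuation_Δ_eq_one`).
* `WeierstrassCurve.not_forall_hasAdditiveReductionAt`: hence the predicate is not universally true
  (good reduction excludes additive reduction, AEC VII.5, Prop. 5.1).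
* `WeierstrassCurve.HasAdditiveReductionAt.valuation_Δ_lt_one`: if `W` is `v`-integral and has
  additive reduction at `v` then `v (Δ (W)) < 1` (`ord_v Δ > 0` for *every* integral equation, since
  the minimal one minimises `ord_v Δ`; AEC VII.1, Definition p. 165, and VII.5, Prop. 5.1(c)).
* `WeierstrassCurve.HasAdditiveReductionAt.valuation_c₄_lt_one`: if moreover `Δ (W) ≠ 0` then also
  `v (c₄ (W)) < 1`: the minimal model is `E • W_{K_v}` with `|u⁻¹|ᵥ ≥ 1` (it does not lower
  `|Δ|ᵥ = |u⁻¹|ᵥ¹² |Δ (W)|ᵥ`), and `c₄ (E • W_{K_v}) = u⁻⁴ c₄ (W)` lies in `𝓜_v`.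
* `WeierstrassCurve.hasAdditiveReductionAt_of_lt_valuation_c₄`: the sufficient direction of
  Prop. 5.1(c) on an integral equation made minimal by the `c₄`-half of AEC VII.1, Remark 1.1: an
  elliptic curve given by a `v`-integral equation with `0 < ord_v (c₄) < 4` and `ord_v (Δ) > 0` has
  additive reduction at `v` (minimality by the tree's `isMinimalAt_of_lt_valuation_c₄`; Mathlib's
  `HasAdditiveReduction` of `W_{K_v}` is the pair of inequalities, read off in `K` by
  `valuation_maximalIdeal_adicCompletion_lt_one_iff`, and it agrees with that of the chosen minimal
  model `E • W_{K_v}` by `hasAdditiveReduction_iff_of_isMinimal_of_eq_smul`, AEC VII.1,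
  Prop. 1.3(b)).

Already in the tree and therefore not restated here: Prop. 5.1(c) verbatim for an equation that is
itself minimal at `v` (`WeierstrassCurve.hasAdditiveReductionAt_iff_of_isMinimalAt` in
`Literature.NumberTheory.EllipticCurves.SzpiroLocalDataProofs`) and the `Δ`-half route
(`0 < ord_v (Δ) < 12`, `ord_v (c₄) > 0` ⟹ additive: `Literature.NumberTheory.EllipticCurves.hasAdditiveReductionAt_of_valuation` in
`Literature.NumberTheory.EllipticCurves.CongruentNumberCurveAdditiveReduction`); both files carry
imports (conductor, `L`-function) that this sibling of `LocalReduction` avoids.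

The hypothesis `[W.IsElliptic]` (equivalently `Δ ≠ 0`) in the `c₄`-statements cannot be dropped:
for `Δ = 0` Mathlib's `IsMinimal` holds for every integral model, the chosen "minimal" model is an
arbitrary one of them, and `v (c₄)` is not constant among them (module docstring of
`LocalReduction`).

## References

* J. H. Silverman, *The Arithmetic of Elliptic Curves*, GTM 106, 2nd ed. 2009 (held:
  `book:silverman2009-arithmetic-elliptic-curves-2nd-ed`), §VII.1 (Definition of a minimal
  equation, Remark 1.1 and Prop. 1.3(b), PDF p. 165) and §VII.5 (Definition, Prop. 5.1(a),(c),
  PDF p. 174).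
-/

open IsDedekindDomain

namespace WeierstrassCurve

section NonUniversal

variable {A : Type*} [CommRing A] [IsDedekindDomain A] {K : Type*} [Field K]
  [Algebra A K] [IsFractionRing A K] (v : HeightOneSpectrum A)

/-- At every finite place `v` of the fraction field `K` of a Dedekind domain `A` there is a
Weierstrass equation over `K` with good reduction at `v`: if `3 ∉ v` the equation `y² + y = x³`
(`Δ = -27 = -3³`, a `v`-unit), and if `3 ∈ v` the equation `y² + xy = x³ - x` (`Δ = 65`, a
`v`-unit because `22 · 3 - 65 = 1`); both have coefficients `0, ±1`, so they are `v`-integral with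
unit discriminant, hence have good reduction (Silverman, AEC VII.5, Prop. 5.1(a) with VII.1,
Remark 1.1; the tree's `hasGoodReductionAt_of_valuation_le_one_of_valuation_Δ_eq_one`).
[cite: SilvermanAEC2009, VII.5 Prop. 5.1(a) (PDF p. 174)] -/
theorem exists_hasGoodReductionAt : ∃ W : WeierstrassCurve K, W.HasGoodReductionAt v := by
  by_cases h3 : (3 : A) ∈ v.asIdeal
  · -- `y² + xy = x³ - x`, `Δ = 65`
    refine ⟨⟨1, 0, 0, -1, 0⟩, hasGoodReductionAt_of_valuation_le_one_of_valuation_Δ_eq_one v _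
      (by simp) (by simp) (by simp) (by simp) (by simp) ?_⟩
    have hΔ : (⟨1, 0, 0, -1, 0⟩ : WeierstrassCurve K).Δ = algebraMap A K 65 := by
      rw [map_ofNat]; simp only [Δ, b₂, b₄, b₆, b₈]; norm_num
    rw [hΔ, HeightOneSpectrum.valuation_eq_one_iff_notMem]
    intro h65
    refine v.isPrime.ne_top ((Ideal.eq_top_iff_one _).mpr ?_)
    have h : (1 : A) = 22 * 3 - 65 := by norm_num
    rw [h]
    exact v.asIdeal.sub_mem (v.asIdeal.mul_mem_left _ h3) h65
  · -- `y² + y = x³`, `Δ = -27`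
    refine ⟨⟨0, 0, 1, 0, 0⟩, hasGoodReductionAt_of_valuation_le_one_of_valuation_Δ_eq_one v _
      (by simp) (by simp) (by simp) (by simp) (by simp) ?_⟩
    have hΔ : (⟨0, 0, 1, 0, 0⟩ : WeierstrassCurve K).Δ = -(algebraMap A K 3) ^ 3 := by
      rw [map_ofNat]; simp only [Δ, b₂, b₄, b₆, b₈]; norm_num
    rw [hΔ, Valuation.map_neg, Valuation.map_pow,
      (HeightOneSpectrum.valuation_eq_one_iff_notMem v).mpr h3, one_pow]

/-- The predicate `WeierstrassCurve.HasAdditiveReductionAt v` is a *definition* (the notion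
"additive reduction at `v`", Silverman, AEC VII.5, Definition and Prop. 5.1(c)), not a universally
valid statement: at every finite place `v` some Weierstrass equation over `K` has good reduction
(`exists_hasGoodReductionAt`), and good reduction excludes additive reduction (Prop. 5.1). (So no
`HasAdditiveReductionAt_holds : ∀ v W, W.HasAdditiveReductionAt v` can exist.)
[cite: SilvermanAEC2009, VII.5 Prop. 5.1(c) (PDF p. 174)] -/
theorem not_forall_hasAdditiveReductionAt :
    ¬ ∀ W : WeierstrassCurve K, W.HasAdditiveReductionAt v := fun h ↦ by
  obtain ⟨W, hW⟩ := exists_hasGoodReductionAt (K := K) v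
  exact hW.not_hasAdditiveReductionAt (h W)

end NonUniversal

section Necessary

variable {A : Type*} [CommRing A] [IsDedekindDomain A] {K : Type*} [Field K]
  [Algebra A K] [IsFractionRing A K] {v : HeightOneSpectrum A} {W : WeierstrassCurve K}

/-- If `W` is `v`-integral and has additive reduction at `v`, then `v (Δ (W)) < 1`, i.e.
`ord_v (Δ) > 0` for *this* equation: the chosen minimal model `M = E • W_{K_v}` has `v (Δ_M) < 1`
(Silverman, AEC VII.5, Prop. 5.1(c)), and by minimality (AEC VII.1, Definition, p. 165: `v (Δ)` is
minimised over the integral equations) the integral equation `W_{K_v} = E⁻¹ • M` has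
`v (Δ (W)) ≤ v (Δ_M)` multiplicatively.
[cite: SilvermanAEC2009, VII.5 Prop. 5.1(c) (PDF p. 174) and VII.1 Definition (PDF p. 165)] -/
theorem HasAdditiveReductionAt.valuation_Δ_lt_one (h : W.HasAdditiveReductionAt v)
    (hW : W.IsIntegralAt v) : v.valuation K W.Δ < 1 := by
  set O := v.adicCompletionIntegers K with hO
  set X := W.baseChange (v.adicCompletion K) with hX
  obtain ⟨E, hE⟩ : ∃ E : VariableChange (v.adicCompletion K), W.localMinimalModel v = E • X :=
    ⟨_, rfl⟩
  have hmin : (W.localMinimalModel v).IsMinimal O := inferInstance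
  have hbad := h.badReduction
  rw [hE] at hmin hbad
  -- minimality of `E • X`, compared with the integral model `X = E⁻¹ • (E • X)`
  have hXint : X.IsIntegral O := hW
  have hj : (E⁻¹ • E • X).IsIntegral O := by rwa [inv_smul_smul]
  have hle : valuation_Δ_aux O (E⁻¹ • E • X) ≤ valuation_Δ_aux O ((1 : VariableChange _) • E • X) :=
    hmin.val_Δ_maximal.le hj
  rw [inv_smul_smul, one_smul, ← Subtype.coe_le_coe, valuation_Δ_aux_eq_of_isIntegral,
    valuation_Δ_aux_eq_of_isIntegral] at hle
  have hlt := hle.trans_lt hbad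
  rw [hX, WeierstrassCurve.baseChange, map_Δ] at hlt
  exact (valuation_maximalIdeal_adicCompletion_lt_one_iff v W.Δ).mp hlt

/-- If an elliptic curve `W` (`Δ ≠ 0`) is `v`-integral and has additive reduction at `v`, then
`v (c₄ (W)) < 1`, i.e. `ord_v (c₄) > 0` for *this* equation. The chosen minimal model is
`M = E • W_{K_v}`; by minimality `|Δ_M|ᵥ = |u⁻¹|ᵥ¹² |Δ (W)|ᵥ ≥ |Δ (W)|ᵥ ≠ 0`, so `|u⁻¹|ᵥ ≥ 1`,
and `c₄ (M) = u⁻⁴ c₄ (W)` (Silverman, AEC VII.1, Remark 1.1 / Table 3.1) gives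
`|c₄ (W)|ᵥ ≤ |c₄ (M)|ᵥ < 1` (AEC VII.5, Prop. 5.1(c)). For `Δ = 0` the statement fails for the
chosen model in general (see the module docstring).
[cite: SilvermanAEC2009, VII.5 Prop. 5.1(c) (PDF p. 174) and VII.1 Remark 1.1 (PDF p. 165)] -/
theorem HasAdditiveReductionAt.valuation_c₄_lt_one [W.IsElliptic] (h : W.HasAdditiveReductionAt v)
    (hW : W.IsIntegralAt v) : v.valuation K W.c₄ < 1 := by
  set O := v.adicCompletionIntegers K with hO
  set X := W.baseChange (v.adicCompletion K) with hX
  obtain ⟨E, hE⟩ : ∃ E : VariableChange (v.adicCompletion K), W.localMinimalModel v = E • X :=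
    ⟨_, rfl⟩
  have hmin : (W.localMinimalModel v).IsMinimal O := inferInstance
  have hadd := h.additiveReduction
  rw [hE] at hmin hadd
  -- minimality of `E • X`, compared with the integral model `X = E⁻¹ • (E • X)`
  have hXint : X.IsIntegral O := hW
  have hj : (E⁻¹ • E • X).IsIntegral O := by rwa [inv_smul_smul]
  have hle : valuation_Δ_aux O (E⁻¹ • E • X) ≤ valuation_Δ_aux O ((1 : VariableChange _) • E • X) :=
    hmin.val_Δ_maximal.le hj
  rw [inv_smul_smul, one_smul, ← Subtype.coe_le_coe, valuation_Δ_aux_eq_of_isIntegral,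
    valuation_Δ_aux_eq_of_isIntegral, variableChange_Δ, map_mul, map_pow] at hle
  -- the valuation `ν` of `K_v` attached to `𝔪_v`; `ν (u⁻¹) ≥ 1`
  set ν := (IsDiscreteValuationRing.maximalIdeal O).valuation (v.adicCompletion K) with hν
  have hΔ0 : ν X.Δ ≠ 0 := by
    rw [Valuation.ne_zero_iff, hX, WeierstrassCurve.baseChange, map_Δ]
    exact (map_ne_zero _).mpr W.isUnit_Δ.ne_zero
  have hu : 1 ≤ ν (↑E.u⁻¹ : v.adicCompletion K) := by
    by_contra hlt
    rw [not_le] at hlt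
    have h12 : ν (↑E.u⁻¹ : v.adicCompletion K) ^ 12 < 1 := pow_lt_one₀ zero_le hlt (by norm_num)
    have := mul_lt_mul_of_pos_right h12 (zero_lt_iff.mpr hΔ0)
    rw [one_mul] at this
    exact absurd hle (not_le.mpr this)
  -- `c₄ (E • X) = u⁻⁴ c₄ (X)`
  rw [variableChange_c₄, map_mul, map_pow] at hadd
  have hc : ν X.c₄ ≤ ν (↑E.u⁻¹ : v.adicCompletion K) ^ 4 * ν X.c₄ :=
    le_mul_of_one_le_left zero_le (one_le_pow₀ hu)
  have hlt := hc.trans_lt hadd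
  rw [hX, WeierstrassCurve.baseChange, map_c₄] at hlt
  exact (valuation_maximalIdeal_adicCompletion_lt_one_iff v W.c₄).mp hlt

end Necessary

section Criterion

variable {A : Type*} [CommRing A] [IsDedekindDomain A] {K : Type*} [Field K]
  [Algebra A K] [IsFractionRing A K] {v : HeightOneSpectrum A} {W : WeierstrassCurve K}

/-- Silverman's criterion for additive reduction read on an integral equation, with minimality
from the `c₄`-half of AEC VII.1, Remark 1.1 (PDF p. 165: "`aᵢ ∈ R` and `v(c_4) < 4` ⟹ the
equation is minimal"): an elliptic curve given by a `v`-integral equation with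
`0 < ord_v (c₄) < 4`, i.e. `exp (-4) < v (c₄) < 1` in `ℤᵐ⁰`, and `v (Δ) < 1` has additive
reduction at `v` (AEC VII.5, Prop. 5.1(c), PDF p. 174: "E has additive reduction if and only if
`v(Δ) > 0` and `v(c_4) > 0`"). Proof: `W_{K_v}` is minimal (`isMinimalAt_of_lt_valuation_c₄`) and
satisfies Mathlib's `HasAdditiveReduction` by the two inequalities
(`valuation_maximalIdeal_adicCompletion_lt_one_iff`); additive reduction is the same for the chosen
minimal model `E • W_{K_v}` (`hasAdditiveReduction_iff_of_isMinimal_of_eq_smul`, AEC VII.1,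
Prop. 1.3(b)). The hypothesis `[W.IsElliptic]` cannot be dropped: for `Δ = 0` the chosen minimal
model is an arbitrary integral model.
[cite: SilvermanAEC2009, VII.5 Prop. 5.1(c) (PDF p. 174) and VII.1 Remark 1.1 (PDF p. 165)] -/
theorem hasAdditiveReductionAt_of_lt_valuation_c₄ [W.IsElliptic] (hW : W.IsIntegralAt v)
    (h4 : WithZero.exp (-4 : ℤ) < v.valuation K W.c₄) (hc₄ : v.valuation K W.c₄ < 1)
    (hΔ : v.valuation K W.Δ < 1) : W.HasAdditiveReductionAt v := by
  set O := v.adicCompletionIntegers K with hO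
  set X := W.baseChange (v.adicCompletion K) with hX
  haveI hmin : X.IsMinimal O := isMinimalAt_of_lt_valuation_c₄ hW h4
  have hΔ0 : X.Δ ≠ 0 := by
    rw [hX, WeierstrassCurve.baseChange, map_Δ]
    exact (map_ne_zero _).mpr W.isUnit_Δ.ne_zero
  obtain ⟨E, hE⟩ : ∃ E : VariableChange (v.adicCompletion K), W.localMinimalModel v = E • X :=
    ⟨_, rfl⟩
  unfold HasAdditiveReductionAt
  rw [hasAdditiveReduction_iff_of_isMinimal_of_eq_smul O hE hΔ0, hasAdditiveReduction_iff]
  refine ⟨hmin, ?_, ?_⟩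
  · rw [hX, WeierstrassCurve.baseChange, map_Δ]
    exact (valuation_maximalIdeal_adicCompletion_lt_one_iff v W.Δ).mpr hΔ
  · rw [hX, WeierstrassCurve.baseChange, map_c₄]
    exact (valuation_maximalIdeal_adicCompletion_lt_one_iff v W.c₄).mpr hc₄

end Criterion

end WeierstrassCurve
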